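import Mathlib
import HarnessLib
import Summits.ABC.ABC.Theses.GlobalQuasiLogDerivative

/-!
# Line `birth` — BC3 skeleton for the crux `SmallCoherentNonConstant` (stmt-ABC-1690)

Route `GlobalQuasiLogDerivative` (route-ABC-GlobalQuasiLogDerivative), crux of rank 2 — the EXISTENCE HORN of the
route's dichotomy:

  `SmallCoherentNonConstant := ∀ ε > 0, ∃ C, ∃ k : ℕ → ℤ, Coherent k ∧ Small ε C k ∧ NonConstant k`

where, writing `D(x,y) := rad x · k y − rad y · k x` (radical computed in `ℕ`, then cast),
  `Coherent k    := ∀ x y ≥ 1 coprime, (x+y) ∣ rad(x+y) · D(x,y)`            (in `ℤ`),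
  `Small ε C k   := ∀ x y ≥ 1 coprime, |D(x,y)| ≤ C · rad x · rad y · (x+y)^ε` (in `ℝ`, `^` = rpow),
  `NonConstant k := ∃ a b ≥ 1, D(a,b) ≠ 0`.

## The line: FINITE LEVELS + COMPACTNESS

The route header lists "the König/compactness glue between finite levels and the infinite statement" under
NOT DECOMPOSED YET; this skeleton makes exactly that cut. LEVEL `N` of the constraint system = the coherence and
smallness clauses restricted to pairs `x, y ≤ N` (all other binders verbatim).

* `stub_finiteLevels` — the ARITHMETIC HEART (open; carries the crux's content): for every `ε > 0` there are `C`
  and a HEIGHT `H` such that EVERY level `N` admits a level-`N` coherent, level-`N` `(ε,C)`-small `k` that is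
  non-constant BELOW `H` (`∃ a b ∈ [1,H]`, `D(a,b) ≠ 0`). The two uniformities are the content: `C` may not grow
  with `N` (per level, `k n = n²·rad n` is feasible with `C = N^(2−ε)`, which is useless), and the witness of
  non-constancy may not recede with `N` (the route's finite evidence at `ε = 1/4`, KILL CRITERIA (2): at fixed `C`
  non-constancy survives only as isolated boundary bumps at smooth `n = 28, 30, 42, 60, 126, 210`, each killed by
  the next prime square — a level family whose witnesses escape to infinity has a CONSTANT limit and proves
  nothing; `H` is what excludes it). Finitary: for rational `ε`, `C` each level is a finite CSP (gauge `k 1 = 0`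
  boxes every `k n`, see below), so the stub is a `∀ N`-statement over decidable predicates, open to induction on
  the level with an invariant, to explicit CRT constructions level by level (the card's germs `σ_p` + archimedean
  control), and it is where all the route's computations live (levels `≤ 318` solved).
* `stub_levelCompactness` — the TOPOLOGICAL GLUE (true; M-sized; provable now): for fixed `ε, C, H`, level-wise
  feasibility with witnesses below `H` ⇒ ONE GLOBAL coherent `(ε,C)`-small `k`, non-constant. Sketch: levels are
  downward monotone in `N`; pigeonhole a witness pair `(a,b) ∈ [1,H]²` recurring for infinitely many `N`; gauge
  `k ↦ k − k(1)·rad` (leaves `D`, hence all three clauses, unchanged) so `k 1 = 0`, whence smallness at the coprime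
  pair `(1,n)` boxes `|k n| ≤ C·rad n·(n+1)^ε` for `1 ≤ n ≤ N`; truncate `k` to `0` above `N` and at `0` (no clause
  reads `k 0` or `k n`, `n > N`); König / Tychonoff on `∏ₙ {−Bₙ,…,Bₙ}` (`ℤ` discrete) gives a cluster point `k`;
  every clause reads `k` at two points only, so it transfers from a level `N ≥ max(x,y)` (resp. `≥ H`) whose
  solution agrees with `k` there. Leans on: `Nat.coprime_one_left`, `UniqueFactorizationMonoid.radical_one`,
  compactness of `Set.pi univ (fun n => Finset…)` in `ℕ → ℤ` (`isCompact_univ_pi` / `IsCompact.exists_clusterPt`)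
  or a hand-rolled diagonal extraction (`Infinite.exists_subset_card_eq` / `Filter` on `ℕ`).
* `smallCoherentNonConstant_of_stubs : sig₁ → sig₂ → (crux statement)` — the composition, sorry-free.
* `SmallCoherentNonConstant_of : SmallCoherentNonConstant` — THE skeleton theorem: the crux BY NAME from the two
  declared stubs (the file's only theorem whose head is the crux name).
* `finiteLevels_of_smallCoherentNonConstant` — EXACTNESS: crux → sig₁ by restriction (sorry-free). So
  `sig₁ ∧ sig₂ → crux → sig₁`, and `sig₂` is an unconditional lemma: the cut loses no strength, `stub_finiteLevels`
  is refutable only by refuting the crux (i.e. by the route's own negative items `Rigidity` ⊇ `PairGluingOneTwo`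
  direction: `Rigidity → ¬crux → ¬sig₁` given `sig₂`). The converse probe `crux → stub₁` succeeds BY THIS THEOREM,
  as it must for an exact cut; the BC3 probes `stubᵢ → crux`, `stubᵢ → ABC` by `exact? | simpa | aesop` all fail
  (seat folder `bc/probe_stub*.lean`).
* CALIBRATION at `ε = 2` (sorry-free): `k n = n²·rad n` (`sqRad`) is coherent (`(x+y) ∣ y² − x²`), `(2,1)`-small
  (`|y² − x²| ≤ (x+y)²`) and separates `1` from `2` (`D(1,2) = 8 − 2`), so the crux matrix and `sig₁`'s matrix hold at
  `ε = 2` with `C = 1`, `H = 2` (`cruxMatrix_at_two`, `finiteLevelsMatrix_at_two`): the typing computes, the stubs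
  are inhabited-in-kind, and the content is `ε < 2` (for the assembly, `ε → 0`).

Disproof used: none exists for this crux at registration (`ledger crux ls stmt-ABC-1690`: no workfiles; no
`Disproof.lean`, no `_false_without_` theorem, no landed `Theorems/SmallCoherentNonConstant/Negative/*`).
Negatives index (`ledger negatives --problem ABC`, 2 entries): stmt-ABC-1689 (this route's unguarded target, killed
by the degenerate triple `(1,1,2)`) and stmt-ABC-1205 (BelyiSqueeze) — neither stub is an instance of either
(the stubs quantify no abc triple; non-constancy asks `D(a,b) ≠ 0` for SOME pair, never at a prescribed triple).
`sorry` occurs ONLY in the two `stub_*` theorems.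
-/

-- `Summit.<Summit>.<Problem>`: for the single-conjunct summit `ABC` the duplicate `ABC.ABC` is mandated.
set_option linter.dupNamespace false
set_option linter.unusedVariables false

namespace Summit.ABC.ABC.Cruxes.SmallCoherentNonConstant.Birth

open Summit.ABC.ABC.Theses.GlobalQuasiLogDerivative

/-! ## The two registered stubs -/

/-- **Stub 1 — finite levels with bounded-height non-constancy (the arithmetic heart; open).**
For every `ε > 0` there are `C : ℝ` and `H : ℕ` such that for every level `N` some `k : ℕ → ℤ` satisfies the
coherence clause and the `(ε,C)`-smallness clause on all coprime pairs `1 ≤ x, y ≤ N` and has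
`rad a · k b ≠ rad b · k a` for some `1 ≤ a, b ≤ H`. Implied by the crux (restriction:
`finiteLevels_of_smallCoherentNonConstant`); gives the crux back through `stub_levelCompactness`. True at
`ε = 2` with `C = 1, H = 2` (`finiteLevelsMatrix_at_two`); the content is `ε < 2`, uniformly in `N`.
Why it might fail: the route's `Rigidity` / `PairGluingOneTwo` mechanism — at small `ε` the moduli `e(x+y)` at
prime-power sums out-count the `≤ 2C·n^ε·rad n` admissible values, and the finite evidence (ε = 1/4, C ≤ 8)
shows witnesses receding to the boundary. Size: crux-hard (L/open). Sources: route header KILL CRITERIA (2)–(3);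
HallRR1971PseudoPolynomials; DelaygueRivoal2022 (arXiv:2102.01534); Pasten2021 (arXiv:2106.16165). -/
theorem stub_finiteLevels :
    ∀ ε : ℝ, 0 < ε → ∃ C : ℝ, ∃ H : ℕ, ∀ N : ℕ, ∃ k : ℕ → ℤ,
      (∀ x y : ℕ, 0 < x → 0 < y → x ≤ N → y ≤ N → Nat.Coprime x y →
        ((x + y : ℕ) : ℤ) ∣ ((UniqueFactorizationMonoid.radical (x + y) : ℕ) : ℤ) *
          (((UniqueFactorizationMonoid.radical x : ℕ) : ℤ) * k y -
            ((UniqueFactorizationMonoid.radical y : ℕ) : ℤ) * k x)) ∧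
      (∀ x y : ℕ, 0 < x → 0 < y → x ≤ N → y ≤ N → Nat.Coprime x y →
        |((UniqueFactorizationMonoid.radical x : ℕ) : ℝ) * (k y : ℝ) -
            ((UniqueFactorizationMonoid.radical y : ℕ) : ℝ) * (k x : ℝ)| ≤
          C * ((UniqueFactorizationMonoid.radical x : ℕ) : ℝ) *
            ((UniqueFactorizationMonoid.radical y : ℕ) : ℝ) * ((x + y : ℕ) : ℝ) ^ ε) ∧
      ∃ a b : ℕ, 0 < a ∧ 0 < b ∧ a ≤ H ∧ b ≤ H ∧
        ((UniqueFactorizationMonoid.radical a : ℕ) : ℤ) * k b ≠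
          ((UniqueFactorizationMonoid.radical b : ℕ) : ℤ) * k a := by
  sorry

/-- **Stub 2 — level compactness (König; true, M-sized, provable now).**
Fix `ε C : ℝ` and a height `H`. If every level `N` admits a level-`N` coherent, level-`N` `(ε,C)`-small
`k : ℕ → ℤ` with a non-constancy witness `1 ≤ a, b ≤ H`, then ONE `k` is coherent and `(ε,C)`-small on ALL
coprime pairs and non-constant. Proof route: pigeonhole the witness pair over `[1,H]²` (levels are downward
monotone in `N`, so "infinitely many `N`" suffices); gauge `k ↦ k − k(1)·rad` (all clauses depend on `k` only
through `D(x,y) = rad x·k y − rad y·k x`, which the gauge fixes) to get `k 1 = 0`; then smallness at the coprime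
pair `(1,n)` gives `|k n| ≤ C·rad n·(n+1)^ε` for `1 ≤ n ≤ N` (finitely many values per coordinate; `k 0` and
`k n, n > N` are read by no clause and may be zeroed); extract a pointwise-eventually-constant subsequence
(König / Tychonoff for `ℕ → ℤ`, `ℤ` discrete) and transfer each clause, which reads `k` at two points, from a
level `N ≥ max x y` agreeing with the limit there. Why it might fail: it does not (standard compactness; the only
traps — `k 0` unconstrained, `C < 0` making every level `N ≥ 1` infeasible — are harmless as stated).
Size: M (≈150–250 lines). Sources: route header KILL CRITERIA ("By König … ¬Target at ε ⟺ …"); folklore. -/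
theorem stub_levelCompactness :
    ∀ (ε C : ℝ) (H : ℕ),
      (∀ N : ℕ, ∃ k : ℕ → ℤ,
        (∀ x y : ℕ, 0 < x → 0 < y → x ≤ N → y ≤ N → Nat.Coprime x y →
          ((x + y : ℕ) : ℤ) ∣ ((UniqueFactorizationMonoid.radical (x + y) : ℕ) : ℤ) *
            (((UniqueFactorizationMonoid.radical x : ℕ) : ℤ) * k y -
              ((UniqueFactorizationMonoid.radical y : ℕ) : ℤ) * k x)) ∧
        (∀ x y : ℕ, 0 < x → 0 < y → x ≤ N → y ≤ N → Nat.Coprime x y →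
          |((UniqueFactorizationMonoid.radical x : ℕ) : ℝ) * (k y : ℝ) -
              ((UniqueFactorizationMonoid.radical y : ℕ) : ℝ) * (k x : ℝ)| ≤
            C * ((UniqueFactorizationMonoid.radical x : ℕ) : ℝ) *
              ((UniqueFactorizationMonoid.radical y : ℕ) : ℝ) * ((x + y : ℕ) : ℝ) ^ ε) ∧
        ∃ a b : ℕ, 0 < a ∧ 0 < b ∧ a ≤ H ∧ b ≤ H ∧
          ((UniqueFactorizationMonoid.radical a : ℕ) : ℤ) * k b ≠
            ((UniqueFactorizationMonoid.radical b : ℕ) : ℤ) * k a) →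
      ∃ k : ℕ → ℤ,
        (∀ x y : ℕ, 0 < x → 0 < y → Nat.Coprime x y →
          ((x + y : ℕ) : ℤ) ∣ ((UniqueFactorizationMonoid.radical (x + y) : ℕ) : ℤ) *
            (((UniqueFactorizationMonoid.radical x : ℕ) : ℤ) * k y -
              ((UniqueFactorizationMonoid.radical y : ℕ) : ℤ) * k x)) ∧
        (∀ x y : ℕ, 0 < x → 0 < y → Nat.Coprime x y →
          |((UniqueFactorizationMonoid.radical x : ℕ) : ℝ) * (k y : ℝ) -
              ((UniqueFactorizationMonoid.radical y : ℕ) : ℝ) * (k x : ℝ)| ≤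
            C * ((UniqueFactorizationMonoid.radical x : ℕ) : ℝ) *
              ((UniqueFactorizationMonoid.radical y : ℕ) : ℝ) * ((x + y : ℕ) : ℝ) ^ ε) ∧
        ∃ a b : ℕ, 0 < a ∧ 0 < b ∧
          ((UniqueFactorizationMonoid.radical a : ℕ) : ℤ) * k b ≠
            ((UniqueFactorizationMonoid.radical b : ℕ) : ℤ) * k a := by
  sorry

/-! ## The composition: the two stubs prove the crux -/

/-- **Composition with explicit hypotheses** (`sig₁ → sig₂ → crux`, the conclusion spelled as the crux's
one-step unfolding so that `SmallCoherentNonConstant_of` below is the file's only theorem whose head is the crux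
name, as the skeleton audit expects). Given `ε > 0`, stub 1 yields `C, H` and a solution of every level with a
witness below `H`; stub 2 at `(ε, C, H)` glues them into one global `k`. Sorry-free. [folklore] -/
theorem smallCoherentNonConstant_of_stubs
    (h₁ : ∀ ε : ℝ, 0 < ε → ∃ C : ℝ, ∃ H : ℕ, ∀ N : ℕ, ∃ k : ℕ → ℤ,
      (∀ x y : ℕ, 0 < x → 0 < y → x ≤ N → y ≤ N → Nat.Coprime x y →
        ((x + y : ℕ) : ℤ) ∣ ((UniqueFactorizationMonoid.radical (x + y) : ℕ) : ℤ) *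
          (((UniqueFactorizationMonoid.radical x : ℕ) : ℤ) * k y -
            ((UniqueFactorizationMonoid.radical y : ℕ) : ℤ) * k x)) ∧
      (∀ x y : ℕ, 0 < x → 0 < y → x ≤ N → y ≤ N → Nat.Coprime x y →
        |((UniqueFactorizationMonoid.radical x : ℕ) : ℝ) * (k y : ℝ) -
            ((UniqueFactorizationMonoid.radical y : ℕ) : ℝ) * (k x : ℝ)| ≤
          C * ((UniqueFactorizationMonoid.radical x : ℕ) : ℝ) *
            ((UniqueFactorizationMonoid.radical y : ℕ) : ℝ) * ((x + y : ℕ) : ℝ) ^ ε) ∧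
      ∃ a b : ℕ, 0 < a ∧ 0 < b ∧ a ≤ H ∧ b ≤ H ∧
        ((UniqueFactorizationMonoid.radical a : ℕ) : ℤ) * k b ≠
          ((UniqueFactorizationMonoid.radical b : ℕ) : ℤ) * k a)
    (h₂ : ∀ (ε C : ℝ) (H : ℕ),
      (∀ N : ℕ, ∃ k : ℕ → ℤ,
        (∀ x y : ℕ, 0 < x → 0 < y → x ≤ N → y ≤ N → Nat.Coprime x y →
          ((x + y : ℕ) : ℤ) ∣ ((UniqueFactorizationMonoid.radical (x + y) : ℕ) : ℤ) *
            (((UniqueFactorizationMonoid.radical x : ℕ) : ℤ) * k y -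
              ((UniqueFactorizationMonoid.radical y : ℕ) : ℤ) * k x)) ∧
        (∀ x y : ℕ, 0 < x → 0 < y → x ≤ N → y ≤ N → Nat.Coprime x y →
          |((UniqueFactorizationMonoid.radical x : ℕ) : ℝ) * (k y : ℝ) -
              ((UniqueFactorizationMonoid.radical y : ℕ) : ℝ) * (k x : ℝ)| ≤
            C * ((UniqueFactorizationMonoid.radical x : ℕ) : ℝ) *
              ((UniqueFactorizationMonoid.radical y : ℕ) : ℝ) * ((x + y : ℕ) : ℝ) ^ ε) ∧
        ∃ a b : ℕ, 0 < a ∧ 0 < b ∧ a ≤ H ∧ b ≤ H ∧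
          ((UniqueFactorizationMonoid.radical a : ℕ) : ℤ) * k b ≠
            ((UniqueFactorizationMonoid.radical b : ℕ) : ℤ) * k a) →
      ∃ k : ℕ → ℤ,
        (∀ x y : ℕ, 0 < x → 0 < y → Nat.Coprime x y →
          ((x + y : ℕ) : ℤ) ∣ ((UniqueFactorizationMonoid.radical (x + y) : ℕ) : ℤ) *
            (((UniqueFactorizationMonoid.radical x : ℕ) : ℤ) * k y -
              ((UniqueFactorizationMonoid.radical y : ℕ) : ℤ) * k x)) ∧
        (∀ x y : ℕ, 0 < x → 0 < y → Nat.Coprime x y →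
          |((UniqueFactorizationMonoid.radical x : ℕ) : ℝ) * (k y : ℝ) -
              ((UniqueFactorizationMonoid.radical y : ℕ) : ℝ) * (k x : ℝ)| ≤
            C * ((UniqueFactorizationMonoid.radical x : ℕ) : ℝ) *
              ((UniqueFactorizationMonoid.radical y : ℕ) : ℝ) * ((x + y : ℕ) : ℝ) ^ ε) ∧
        ∃ a b : ℕ, 0 < a ∧ 0 < b ∧
          ((UniqueFactorizationMonoid.radical a : ℕ) : ℤ) * k b ≠
            ((UniqueFactorizationMonoid.radical b : ℕ) : ℤ) * k a) :
    ∀ ε : ℝ, 0 < ε → ∃ C : ℝ, ∃ k : ℕ → ℤ,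
      (∀ x y : ℕ, 0 < x → 0 < y → Nat.Coprime x y →
        ((x + y : ℕ) : ℤ) ∣ ((UniqueFactorizationMonoid.radical (x + y) : ℕ) : ℤ) *
          (((UniqueFactorizationMonoid.radical x : ℕ) : ℤ) * k y -
            ((UniqueFactorizationMonoid.radical y : ℕ) : ℤ) * k x)) ∧
      (∀ x y : ℕ, 0 < x → 0 < y → Nat.Coprime x y →
        |((UniqueFactorizationMonoid.radical x : ℕ) : ℝ) * (k y : ℝ) -
            ((UniqueFactorizationMonoid.radical y : ℕ) : ℝ) * (k x : ℝ)| ≤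
          C * ((UniqueFactorizationMonoid.radical x : ℕ) : ℝ) *
            ((UniqueFactorizationMonoid.radical y : ℕ) : ℝ) * ((x + y : ℕ) : ℝ) ^ ε) ∧
      ∃ a b : ℕ, 0 < a ∧ 0 < b ∧
        ((UniqueFactorizationMonoid.radical a : ℕ) : ℤ) * k b ≠
          ((UniqueFactorizationMonoid.radical b : ℕ) : ℤ) * k a := by
  intro ε hε
  obtain ⟨C, H, hlev⟩ := h₁ ε hε
  exact ⟨C, h₂ ε C H hlev⟩

/-- **THE SKELETON THEOREM.** The crux `Summit.ABC.ABC.Theses.GlobalQuasiLogDerivative.SmallCoherentNonConstant`,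
concluded BY NAME from the two DECLARED stubs `stub_finiteLevels` and `stub_levelCompactness` (the only `sorry`s
of the file) through the sorry-free composition `smallCoherentNonConstant_of_stubs`. [folklore] -/
theorem SmallCoherentNonConstant_of :
    Summit.ABC.ABC.Theses.GlobalQuasiLogDerivative.SmallCoherentNonConstant :=
  smallCoherentNonConstant_of_stubs stub_finiteLevels stub_levelCompactness

/-! ## Exactness: the crux gives stub 1 back by restriction (sorry-free) -/

/-- **Exactness of the cut.** `SmallCoherentNonConstant → sig₁`: restrict a global solution to each level and
take `H := max a b` for its witness pair. Hence `sig₁ ∧ sig₂ ↔ crux ∧ sig₂`, and since `sig₂` is an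
unconditional (true) compactness lemma, stub 1 is EQUIVALENT to the crux — refutable only through the route's
own negative items. [folklore] -/
theorem finiteLevels_of_smallCoherentNonConstant
    (h : Summit.ABC.ABC.Theses.GlobalQuasiLogDerivative.SmallCoherentNonConstant) :
    ∀ ε : ℝ, 0 < ε → ∃ C : ℝ, ∃ H : ℕ, ∀ N : ℕ, ∃ k : ℕ → ℤ,
      (∀ x y : ℕ, 0 < x → 0 < y → x ≤ N → y ≤ N → Nat.Coprime x y →
        ((x + y : ℕ) : ℤ) ∣ ((UniqueFactorizationMonoid.radical (x + y) : ℕ) : ℤ) *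
          (((UniqueFactorizationMonoid.radical x : ℕ) : ℤ) * k y -
            ((UniqueFactorizationMonoid.radical y : ℕ) : ℤ) * k x)) ∧
      (∀ x y : ℕ, 0 < x → 0 < y → x ≤ N → y ≤ N → Nat.Coprime x y →
        |((UniqueFactorizationMonoid.radical x : ℕ) : ℝ) * (k y : ℝ) -
            ((UniqueFactorizationMonoid.radical y : ℕ) : ℝ) * (k x : ℝ)| ≤
          C * ((UniqueFactorizationMonoid.radical x : ℕ) : ℝ) *
            ((UniqueFactorizationMonoid.radical y : ℕ) : ℝ) * ((x + y : ℕ) : ℝ) ^ ε) ∧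
      ∃ a b : ℕ, 0 < a ∧ 0 < b ∧ a ≤ H ∧ b ≤ H ∧
        ((UniqueFactorizationMonoid.radical a : ℕ) : ℤ) * k b ≠
          ((UniqueFactorizationMonoid.radical b : ℕ) : ℤ) * k a := by
  intro ε hε
  obtain ⟨C, k, hcoh, hsm, a, b, ha, hb, hab⟩ := h ε hε
  refine ⟨C, max a b, fun N => ⟨k, ?_, ?_, a, b, ha, hb, le_max_left a b, le_max_right a b, hab⟩⟩
  · intro x y hx hy _ _ hxy
    exact hcoh x y hx hy hxy
  · intro x y hx hy _ _ hxy
    exact hsm x y hx hy hxy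

/-! ## Calibration at `ε = 2` (sorry-free): `k n = n² · rad n` -/

/-- The even-polynomial solution `s(n) = n²`, i.e. `k n = n² · rad n`. -/
noncomputable def sqRad (n : ℕ) : ℤ := ((n : ℤ) ^ 2) * ((UniqueFactorizationMonoid.radical n : ℕ) : ℤ)

/-- `sqRad` is coherent on EVERY pair: `rad(x+y)·D(x,y) = rad(x+y)·rad x·rad y·(y−x)·(x+y)`. [folklore] -/
theorem sqRad_coherent (x y : ℕ) :
    ((x + y : ℕ) : ℤ) ∣ ((UniqueFactorizationMonoid.radical (x + y) : ℕ) : ℤ) *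
      (((UniqueFactorizationMonoid.radical x : ℕ) : ℤ) * sqRad y -
        ((UniqueFactorizationMonoid.radical y : ℕ) : ℤ) * sqRad x) := by
  refine ⟨((UniqueFactorizationMonoid.radical (x + y) : ℕ) : ℤ) *
      ((UniqueFactorizationMonoid.radical x : ℕ) : ℤ) * ((UniqueFactorizationMonoid.radical y : ℕ) : ℤ) *
        ((y : ℤ) - (x : ℤ)), ?_⟩
  unfold sqRad
  push_cast
  ring

/-- `sqRad` is `(2,1)`-small on EVERY pair: `|D(x,y)| = rad x·rad y·|y² − x²| ≤ rad x·rad y·(x+y)²`. [folklore] -/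
theorem sqRad_small (x y : ℕ) :
    |((UniqueFactorizationMonoid.radical x : ℕ) : ℝ) * (sqRad y : ℝ) -
        ((UniqueFactorizationMonoid.radical y : ℕ) : ℝ) * (sqRad x : ℝ)| ≤
      1 * ((UniqueFactorizationMonoid.radical x : ℕ) : ℝ) *
        ((UniqueFactorizationMonoid.radical y : ℕ) : ℝ) * ((x + y : ℕ) : ℝ) ^ (2 : ℝ) := by
  have e : ((UniqueFactorizationMonoid.radical x : ℕ) : ℝ) * (sqRad y : ℝ) -
        ((UniqueFactorizationMonoid.radical y : ℕ) : ℝ) * (sqRad x : ℝ) =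
      (((UniqueFactorizationMonoid.radical x : ℕ) : ℝ) * ((UniqueFactorizationMonoid.radical y : ℕ) : ℝ)) *
        (((y : ℝ)) ^ 2 - ((x : ℝ)) ^ 2) := by
    unfold sqRad
    push_cast
    ring
  have hR : (0 : ℝ) ≤ ((UniqueFactorizationMonoid.radical x : ℕ) : ℝ) *
      ((UniqueFactorizationMonoid.radical y : ℕ) : ℝ) := by
    positivity
  have hb : |((y : ℝ)) ^ 2 - ((x : ℝ)) ^ 2| ≤ ((x + y : ℕ) : ℝ) ^ (2 : ℝ) := by
    rw [Real.rpow_two]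
    push_cast
    have hx : (0 : ℝ) ≤ (x : ℝ) := Nat.cast_nonneg x
    have hy : (0 : ℝ) ≤ (y : ℝ) := Nat.cast_nonneg y
    rw [abs_le]
    constructor <;> nlinarith
  rw [e, abs_mul, abs_of_nonneg hR]
  calc ((UniqueFactorizationMonoid.radical x : ℕ) : ℝ) * ((UniqueFactorizationMonoid.radical y : ℕ) : ℝ) *
          |((y : ℝ)) ^ 2 - ((x : ℝ)) ^ 2|
        ≤ ((UniqueFactorizationMonoid.radical x : ℕ) : ℝ) * ((UniqueFactorizationMonoid.radical y : ℕ) : ℝ) *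
          ((x + y : ℕ) : ℝ) ^ (2 : ℝ) := mul_le_mul_of_nonneg_left hb hR
    _ = 1 * ((UniqueFactorizationMonoid.radical x : ℕ) : ℝ) *
          ((UniqueFactorizationMonoid.radical y : ℕ) : ℝ) * ((x + y : ℕ) : ℝ) ^ (2 : ℝ) := by ring

/-- `rad 2 = 2` in `ℕ`. [folklore] -/
theorem radical_two : UniqueFactorizationMonoid.radical (2 : ℕ) = 2 := by
  rw [Nat.radical_eq_prod_primeFactors, Nat.prime_two.primeFactors, Finset.prod_singleton]

/-- `sqRad` separates `1` from `2`: `rad 1 · k 2 = 8 ≠ 2 = rad 2 · k 1`. [folklore] -/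
theorem sqRad_sep :
    ((UniqueFactorizationMonoid.radical 1 : ℕ) : ℤ) * sqRad 2 ≠
      ((UniqueFactorizationMonoid.radical 2 : ℕ) : ℤ) * sqRad 1 := by
  unfold sqRad
  rw [UniqueFactorizationMonoid.radical_one, radical_two]
  norm_num

/-- **The crux matrix at `ε = 2`** (with `C = 1`): the typing of `SmallCoherentNonConstant` computes and is
inhabited-in-kind; the content of the crux is `ε < 2`. [folklore] -/
theorem cruxMatrix_at_two :
    ∃ C : ℝ, ∃ k : ℕ → ℤ,
      (∀ x y : ℕ, 0 < x → 0 < y → Nat.Coprime x y →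
        ((x + y : ℕ) : ℤ) ∣ ((UniqueFactorizationMonoid.radical (x + y) : ℕ) : ℤ) *
          (((UniqueFactorizationMonoid.radical x : ℕ) : ℤ) * k y -
            ((UniqueFactorizationMonoid.radical y : ℕ) : ℤ) * k x)) ∧
      (∀ x y : ℕ, 0 < x → 0 < y → Nat.Coprime x y →
        |((UniqueFactorizationMonoid.radical x : ℕ) : ℝ) * (k y : ℝ) -
            ((UniqueFactorizationMonoid.radical y : ℕ) : ℝ) * (k x : ℝ)| ≤
          C * ((UniqueFactorizationMonoid.radical x : ℕ) : ℝ) *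
            ((UniqueFactorizationMonoid.radical y : ℕ) : ℝ) * ((x + y : ℕ) : ℝ) ^ (2 : ℝ)) ∧
      ∃ a b : ℕ, 0 < a ∧ 0 < b ∧
        ((UniqueFactorizationMonoid.radical a : ℕ) : ℤ) * k b ≠
          ((UniqueFactorizationMonoid.radical b : ℕ) : ℤ) * k a :=
  ⟨1, sqRad, fun x y _ _ _ => sqRad_coherent x y, fun x y _ _ _ => sqRad_small x y,
    1, 2, Nat.one_pos, Nat.two_pos, sqRad_sep⟩

/-- **Stub 1's matrix at `ε = 2`** (with `C = 1`, `H = 2`, the same `k` at every level): the level clauses and the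
bounded-height witness are typed as intended. [folklore] -/
theorem finiteLevelsMatrix_at_two :
    ∃ C : ℝ, ∃ H : ℕ, ∀ N : ℕ, ∃ k : ℕ → ℤ,
      (∀ x y : ℕ, 0 < x → 0 < y → x ≤ N → y ≤ N → Nat.Coprime x y →
        ((x + y : ℕ) : ℤ) ∣ ((UniqueFactorizationMonoid.radical (x + y) : ℕ) : ℤ) *
          (((UniqueFactorizationMonoid.radical x : ℕ) : ℤ) * k y -
            ((UniqueFactorizationMonoid.radical y : ℕ) : ℤ) * k x)) ∧
      (∀ x y : ℕ, 0 < x → 0 < y → x ≤ N → y ≤ N → Nat.Coprime x y →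
        |((UniqueFactorizationMonoid.radical x : ℕ) : ℝ) * (k y : ℝ) -
            ((UniqueFactorizationMonoid.radical y : ℕ) : ℝ) * (k x : ℝ)| ≤
          C * ((UniqueFactorizationMonoid.radical x : ℕ) : ℝ) *
            ((UniqueFactorizationMonoid.radical y : ℕ) : ℝ) * ((x + y : ℕ) : ℝ) ^ (2 : ℝ)) ∧
      ∃ a b : ℕ, 0 < a ∧ 0 < b ∧ a ≤ H ∧ b ≤ H ∧
        ((UniqueFactorizationMonoid.radical a : ℕ) : ℤ) * k b ≠
          ((UniqueFactorizationMonoid.radical b : ℕ) : ℤ) * k a :=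
  ⟨1, 2, fun _ => ⟨sqRad, fun x y _ _ _ _ _ => sqRad_coherent x y, fun x y _ _ _ _ _ => sqRad_small x y,
    1, 2, Nat.one_pos, Nat.two_pos, by norm_num, le_rfl, sqRad_sep⟩⟩

end Summit.ABC.ABC.Cruxes.SmallCoherentNonConstant.Birth
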